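import Summits.QuantumFields.YangMills.Theorems.FluctuationComparisonRegPrIntLS2BetaRelativeKeyLemmaTorus
import Summits.QuantumFields.YangMills.Theorems.FluctuationComparisonRegPrIntLS2BetaRelativeHstepHjHist
import HarnessLib

/-!
# S2β · letter (D♮)∕(D-stage) REL-TEL, the (C)-half — ★★★ THE RELATIVE KEY LEMMA TOWER ON A `d = 3` TORUS, HISTORY-RADIUS EDITION (WINDOW-FREE)
# (✓∕⧗`relHstep_hj_hist` at every level `t < m` ∘ ✓p825006 `relKeyLemma_torus_of_step`; = ✓p826733 `relKeyLemma_torus_arc` WITHOUT the window sups `βWs, βAs ≤ 1∕12800`):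
# `‖δ_t‖₂ ≤ exp(Σ_{i<m}(26((d+2)L)²θ_i + ε_i∕√L))·((√L)^t·‖δ_0‖₂ + Σ_{s<t}(√L)^{t−1−s}·η_s)`, `ε_i = (κW_i·cWε_i + κA_i·cAε_i)·√N_□`,
# `η_s = (κW_s·cWβ_s + κA_s·cAβ_s + 5L³θ₀,s)·√N_b·‖bdev_s‖₂`, `κW_t = 1.4·10⁶((d+2)L)²θ_t` (history size, LOOP datum only), `κA_t = 7·10⁵((d+2)L)²θ₀,t` (BKG) —
# the KEYREL supplier's (C)-side input: `η_s ∝ θ₀,s` as soon as the loop supplier's bdev coefficient `cWβ_s ∝ θ₀,s`, and NO sup-closeness of the two towers is asked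

Cell `ym3-torus` (rung R3 = continuum `SU(2)` Yang–Mills on the three-torus — NOT d = 4, NOT infinite volume, NOT a mass gap, NOT Clay).
Width seat «width 10» `ym3-torus-px10` (gen 24), FREE px helper on crux `stmt-QuantumFields-20520`, count-neutral, DEFINITION-FREE; own-risk brick of the px10 lane
(the KEYREL supplier road, UV3-NODE §82.7).  INPUTS per level `t < m` of the two `exp[mean log]` averaging towers on `SU(N)` (`P.d = 3`, `m ≤ P.m + P.K`): FIELD history
threshold `θ_t` (`PlaqSmall θ_t (M^tU)`, `((d+2)L)²θ_t ≤ 1∕800`, guard), BKG size `0 ≤ θ₀,t ≤ θ_t` (`PlaqSmall θ₀,t (M^tU₀)`), LOOP data `0 ≤ β_W,t Q` (four bonds'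
relative `loopHol`), TRANSPORT data `0 ≤ β_A,t Q` (relative `axialAvg`, staircase), SUPPLIED by `β_W ≤ cWβ·Σ_{near}bdev + cWε·Σ_{near}δ`, `β_A ≤ cAβ·Σ_{near}bdev +
cAε·Σ_{near}δ`; OUTPUT = the displayed tower bound for every `t ≤ m`.  Proof = ✓p826733's, one hypothesis list shorter.
* ★★★ `relKeyLemma_torus_hist`.

HONEST SCOPE.  A composition of landed∕signed letters; nothing of Bałaban's renormalisation analysis asserted or proved; on the T³ RECORD the inputs are OWED to the
KEYREL door (BKG-tower letter, thresholds, suppliers); KEYREL, (H♭♭), (D-stage), GAP♯∘ (`stub_uniformFibreGapOrbit`), S2β, crux 20520 and `YM3TorusSU2` are NOT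
proved; no registered stub is closed; the Yang–Mills mass gap is NOT proved.  Sorry-free, axioms standard.  References: T. Bałaban, CMP **98** (1985) 17–51
[Balaban1985Averaging] ((19) p.21); CMP **99** (1985) 75–102 [Balaban1985RegularSpaces] (Lemma 1 p.79, Thm 2 p.83); CMP **109** (1987) 249–301 [Balaban1987RG1]
((0.4)–(0.8) p.253, §3 p.273).
-/

set_option autoImplicit false

noncomputable section

open Finset
open scoped BigOperators

namespace Summit.QuantumFields.YangMills.Theorems.FluctuationComparisonRegPrIntLS2BetaRelativeKeyLemmaTorusHist

open Literature.MathematicalPhysics.QuantumFieldTheory.Balaban1983to89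
open T4Continuum BlockAveraging AveragingRT
open Literature.MathematicalPhysics.QuantumFieldTheory.Balaban1983to89.ExpMeanLog (expMeanLogSU deltaSU)
open Literature.MathematicalPhysics.QuantumFieldTheory.Balaban1983to89.T4TiltOscillation (bdev)
open B10Eq47AxialChi (shiftN)
open Summit.QuantumFields.YangMills.Theorems.FluctuationComparisonRegPrIntLS2BetaRelativeKeyLemmaTorus (relKeyLemma_torus_of_step)
open Summit.QuantumFields.YangMills.Theorems.FluctuationComparisonRegPrIntLS2BetaRelativeHstepHjHist (relHstep_hj_hist)

variable {P : Params} {n : Type*} [Fintype n] [DecidableEq n] [Nonempty n]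

/-- ★★★ **THE RELATIVE KEY LEMMA TOWER ON A `d = 3` TORUS, HISTORY-RADIUS EDITION (WINDOW-FREE)** (`M^t := Averaging.iter (blockAvg expMeanLogSU) t`;
inputs in the module docstring; no sup hypothesis on the local data).  For every `t ≤ m`:
`‖δ_t‖₂ ≤ exp(Σ_{i<m}(26·((d+2)L)²θ_i + (κW_i·cWε_i + κA_i·cAε_i)·√((3^dL^dd²)(3^dd²))∕√L))·((√L)^t·‖δ_0‖₂ + Σ_{s<t}(√L)^{t−1−s}·(κW_s·cWβ_s + κA_s·cAβ_s + 5L³θ₀,s)·√((3^dL^dd)(3^dd²))·‖bdev_s‖₂)`,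
`κW_t = 1400000·((d+2)L)²θ_t`, `κA_t = 700000·((d+2)L)²θ₀,t`. [cite: Balaban1985Averaging, (19) p.21; Balaban1985RegularSpaces, Lemma 1 p.79] -/
theorem relKeyLemma_torus_hist (hd : P.d = 3) {m : ℕ} (hm : m ≤ P.m + P.K) (U U₀ : GaugeField P 0 (Matrix.specialUnitaryGroup n ℂ))
    (θ θ₀ cWβ cWε cAβ cAε : ℕ → ℝ) (hθ₀0 : ∀ t, t < m → 0 ≤ θ₀ t) (hθ₀θ : ∀ t, t < m → θ₀ t ≤ θ t)
    (hθ : ∀ t, t < m → (((P.d + 2) * P.L : ℕ) : ℝ) ^ 2 * θ t ≤ 1 / 800) (hδ : ∀ t, t < m → (((P.d + 2) * P.L : ℕ) : ℝ) ^ 2 / 4 * θ t < deltaSU n)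
    (hU : ∀ t, t < m → PlaqSmall (θ t) (Averaging.iter (fun k => blockAvg (P := P) (j := k) (expMeanLogSU (n := n))) t U))
    (hU₀ : ∀ t, t < m → PlaqSmall (θ₀ t) (Averaging.iter (fun k => blockAvg (P := P) (j := k) (expMeanLogSU (n := n))) t U₀))
    (βW βA : (t : ℕ) → Plaq P (t + 1) → ℝ) (hβW0 : ∀ t, t < m → ∀ Q, 0 ≤ βW t Q) (hβA0 : ∀ t, t < m → ∀ Q, 0 ≤ βA t Q)
    (hcWβ : ∀ t, t < m → 0 ≤ cWβ t) (hcWε : ∀ t, t < m → 0 ≤ cWε t) (hcAβ : ∀ t, t < m → 0 ≤ cAβ t) (hcAε : ∀ t, t < m → 0 ≤ cAε t)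
    (hW : ∀ t, t < m → ∀ (Q : Plaq P (t + 1)) (c : PBond P (t + 1)), (c = ⟨Q.src, Q.μ⟩ ∨ c = ⟨Q.src.shift Q.μ, Q.ν⟩ ∨ c = ⟨Q.src.shift Q.ν, Q.μ⟩ ∨ c = ⟨Q.src, Q.ν⟩) →
      ∀ i, dist1 ((loopHol (Averaging.iter (fun k => blockAvg (P := P) (j := k) (expMeanLogSU (n := n))) t U₀) c i)⁻¹ *
        loopHol (Averaging.iter (fun k => blockAvg (P := P) (j := k) (expMeanLogSU (n := n))) t U) c i) ≤ βW t Q)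
    (hA : ∀ t, t < m → ∀ (Q : Plaq P (t + 1)) (c : PBond P (t + 1)), (c = ⟨Q.src, Q.μ⟩ ∨ c = ⟨Q.src.shift Q.μ, Q.ν⟩ ∨ c = ⟨Q.src.shift Q.ν, Q.μ⟩ ∨ c = ⟨Q.src, Q.ν⟩) →
      dist1 ((axialAvg (Averaging.iter (fun k => blockAvg (P := P) (j := k) (expMeanLogSU (n := n))) t U₀) c)⁻¹ *
        axialAvg (Averaging.iter (fun k => blockAvg (P := P) (j := k) (expMeanLogSU (n := n))) t U) c) ≤ βA t Q)
    (hS : ∀ t, t < m → ∀ (Q : Plaq P (t + 1)) (i : Idx P),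
      dist1 ((holAt (Averaging.iter (fun k => blockAvg (P := P) (j := k) (expMeanLogSU (n := n))) t U₀) (walk (emb Q.src) (stairWord i.2.1 (off i.1))))⁻¹ *
        holAt (Averaging.iter (fun k => blockAvg (P := P) (j := k) (expMeanLogSU (n := n))) t U) (walk (emb Q.src) (stairWord i.2.1 (off i.1)))) ≤ βA t Q)
    (hβWsupp : ∀ t, t < m → ∀ Q : Plaq P (t + 1), βW t Q ≤
      cWβ t * ∑ c ∈ Finset.univ.filter (fun c : PBond P t => ∀ κ, blockOf c.src κ = Q.src κ ∨ blockOf c.src κ = Q.src κ + 1 ∨ blockOf c.src κ = Q.src κ - 1),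
        dist1 (bdev (Averaging.iter (fun k => blockAvg (P := P) (j := k) (expMeanLogSU (n := n))) t U)
          (Averaging.iter (fun k => blockAvg (P := P) (j := k) (expMeanLogSU (n := n))) t U₀) c) +
      cWε t * ∑ q ∈ Finset.univ.filter (fun q : Plaq P t => ∀ κ, blockOf q.src κ = Q.src κ ∨ blockOf q.src κ = Q.src κ + 1 ∨ blockOf q.src κ = Q.src κ - 1),
        dist1 ((GaugeField.plaqHol (Averaging.iter (fun k => blockAvg (P := P) (j := k) (expMeanLogSU (n := n))) t U₀) q)⁻¹ *
          GaugeField.plaqHol (Averaging.iter (fun k => blockAvg (P := P) (j := k) (expMeanLogSU (n := n))) t U) q))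
    (hβAsupp : ∀ t, t < m → ∀ Q : Plaq P (t + 1), βA t Q ≤
      cAβ t * ∑ c ∈ Finset.univ.filter (fun c : PBond P t => ∀ κ, blockOf c.src κ = Q.src κ ∨ blockOf c.src κ = Q.src κ + 1 ∨ blockOf c.src κ = Q.src κ - 1),
        dist1 (bdev (Averaging.iter (fun k => blockAvg (P := P) (j := k) (expMeanLogSU (n := n))) t U)
          (Averaging.iter (fun k => blockAvg (P := P) (j := k) (expMeanLogSU (n := n))) t U₀) c) +
      cAε t * ∑ q ∈ Finset.univ.filter (fun q : Plaq P t => ∀ κ, blockOf q.src κ = Q.src κ ∨ blockOf q.src κ = Q.src κ + 1 ∨ blockOf q.src κ = Q.src κ - 1),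
        dist1 ((GaugeField.plaqHol (Averaging.iter (fun k => blockAvg (P := P) (j := k) (expMeanLogSU (n := n))) t U₀) q)⁻¹ *
          GaugeField.plaqHol (Averaging.iter (fun k => blockAvg (P := P) (j := k) (expMeanLogSU (n := n))) t U) q)) :
    ∀ t, t ≤ m →
      √(∑ p : Plaq P t, dist1 ((GaugeField.plaqHol (Averaging.iter (fun k => blockAvg (P := P) (j := k) (expMeanLogSU (n := n))) t U₀) p)⁻¹ *
          GaugeField.plaqHol (Averaging.iter (fun k => blockAvg (P := P) (j := k) (expMeanLogSU (n := n))) t U) p) ^ 2) ≤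
        Real.exp (∑ i ∈ range m, (26 * ((((P.d + 2) * P.L : ℕ) : ℝ) ^ 2 * θ i) +
            ((1400000 * ((((P.d + 2) * P.L : ℕ) : ℝ) ^ 2 * θ i)) * cWε i + (700000 * ((((P.d + 2) * P.L : ℕ) : ℝ) ^ 2 * θ₀ i)) * cAε i) *
              √(((3 ^ P.d * P.L ^ P.d * P.d ^ 2 : ℕ) : ℝ) * ((3 ^ P.d * P.d ^ 2 : ℕ) : ℝ)) / Real.sqrt (P.L : ℝ))) *
          (Real.sqrt (P.L : ℝ) ^ t * √(∑ p : Plaq P 0, dist1 ((GaugeField.plaqHol U₀ p)⁻¹ * GaugeField.plaqHol U p) ^ 2) +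
            ∑ s ∈ range t, Real.sqrt (P.L : ℝ) ^ (t - 1 - s) *
              (((1400000 * ((((P.d + 2) * P.L : ℕ) : ℝ) ^ 2 * θ s)) * cWβ s + (700000 * ((((P.d + 2) * P.L : ℕ) : ℝ) ^ 2 * θ₀ s)) * cAβ s + 5 * (P.L : ℝ) ^ 3 * θ₀ s) *
                √(((3 ^ P.d * P.L ^ P.d * P.d : ℕ) : ℝ) * ((3 ^ P.d * P.d ^ 2 : ℕ) : ℝ)) *
                √(∑ c : PBond P s, dist1 (bdev (Averaging.iter (fun k => blockAvg (P := P) (j := k) (expMeanLogSU (n := n))) s U)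
                  (Averaging.iter (fun k => blockAvg (P := P) (j := k) (expMeanLogSU (n := n))) s U₀) c) ^ 2))) := by
  have hlev : ∀ t, t < m → t + 1 ≤ P.m + P.K := fun t ht => by omega
  -- the per-level `hstep`∕`hj` pair (✓`relHstep_hj_arc` at level `t` on the pair `(M^tU, M^tU₀)`)
  have H := fun t (ht : t < m) => relHstep_hj_hist (hlev t ht)
    (Averaging.iter (fun k => blockAvg (P := P) (j := k) (expMeanLogSU (n := n))) t U)
    (Averaging.iter (fun k => blockAvg (P := P) (j := k) (expMeanLogSU (n := n))) t U₀)
    (hθ₀0 t ht) (hθ₀θ t ht) (hθ t ht) (hδ t ht) (hU t ht) (hU₀ t ht) (βW t) (βA t) (hβW0 t ht) (hβA0 t ht)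
    (hcWβ t ht) (hcWε t ht) (hcAβ t ht) (hcAε t ht) (hW t ht) (hA t ht) (hS t ht) (hβWsupp t ht) (hβAsupp t ht)
  have hθ0 : ∀ t, t < m → 0 ≤ (((P.d + 2) * P.L : ℕ) : ℝ) ^ 2 * θ t := fun t ht =>
    mul_nonneg (sq_nonneg _) ((hθ₀0 t ht).trans (hθ₀θ t ht))
  have hκW0 : ∀ t, t < m → 0 ≤ (1400000 * ((((P.d + 2) * P.L : ℕ) : ℝ) ^ 2 * θ t)) := fun t ht => by
    have := hθ0 t ht; positivity
  have hκA0 : ∀ t, t < m → 0 ≤ (700000 * ((((P.d + 2) * P.L : ℕ) : ℝ) ^ 2 * θ₀ t)) := fun t ht => by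
    have := hθ₀0 t ht; positivity
  exact relKeyLemma_torus_of_step hd (expMeanLogSU (n := n)) hm U U₀ (fun t => (((P.d + 2) * P.L : ℕ) : ℝ) ^ 2 * θ t)
    (fun t => ((1400000 * ((((P.d + 2) * P.L : ℕ) : ℝ) ^ 2 * θ t)) * cWε t + (700000 * ((((P.d + 2) * P.L : ℕ) : ℝ) ^ 2 * θ₀ t)) * cAε t) *
      √(((3 ^ P.d * P.L ^ P.d * P.d ^ 2 : ℕ) : ℝ) * ((3 ^ P.d * P.d ^ 2 : ℕ) : ℝ)))
    (fun s => ((1400000 * ((((P.d + 2) * P.L : ℕ) : ℝ) ^ 2 * θ s)) * cWβ s + (700000 * ((((P.d + 2) * P.L : ℕ) : ℝ) ^ 2 * θ₀ s)) * cAβ s + 5 * (P.L : ℝ) ^ 3 * θ₀ s) *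
      √(((3 ^ P.d * P.L ^ P.d * P.d : ℕ) : ℝ) * ((3 ^ P.d * P.d ^ 2 : ℕ) : ℝ)) *
      √(∑ c : PBond P s, dist1 (bdev (Averaging.iter (fun k => blockAvg (P := P) (j := k) (expMeanLogSU (n := n))) s U)
        (Averaging.iter (fun k => blockAvg (P := P) (j := k) (expMeanLogSU (n := n))) s U₀) c) ^ 2))
    hθ0 (fun t ht => by have := hκW0 t ht; have := hκA0 t ht; have := hcWε t ht; have := hcAε t ht; positivity)
    (fun t ht => by have := hκW0 t ht; have := hκA0 t ht; have := hcWβ t ht; have := hcAβ t ht; have := hθ₀0 t ht; positivity) (by norm_num : (0 : ℝ) ≤ 26)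
    (fun t Q => (1400000 * ((((P.d + 2) * P.L : ℕ) : ℝ) ^ 2 * θ t)) * βW t Q + (700000 * ((((P.d + 2) * P.L : ℕ) : ℝ) ^ 2 * θ₀ t)) * βA t Q +
      5 * (P.L : ℝ) ^ 3 * θ₀ t * ∑ c ∈ Finset.univ.filter (fun c : PBond P t => ∀ κ, blockOf c.src κ = Q.src κ ∨ blockOf c.src κ = Q.src κ + 1),
        dist1 (bdev (Averaging.iter (fun k => blockAvg (P := P) (j := k) (expMeanLogSU (n := n))) t U)
          (Averaging.iter (fun k => blockAvg (P := P) (j := k) (expMeanLogSU (n := n))) t U₀) c))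
    (fun t ht Q => (H t ht).1 Q) (fun t ht => (H t ht).2)

end Summit.QuantumFields.YangMills.Theorems.FluctuationComparisonRegPrIntLS2BetaRelativeKeyLemmaTorusHist

end
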